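import Literature.Computability.AlgebraicComplexity.Shafiei15CactusRankBound
import Mathlib.Data.Finsupp.Interval
import HarnessLib

/-!
# Ranestad–Schreyer 2011, Corollary 2: the cactus rank of a monomial,
# `cr(x_0^{d_0} ⋯ x_n^{d_n}) = (d_0+1)⋯(d_{n-1}+1)` (`d_n` the largest exponent)

Topic `Literature/Computability/AlgebraicComplexity`; sequel of `Shafiei15CactusRankBound.lean`
(Ranestad–Schreyer's Proposition 1 for schemes). Source: K. Ranestad, F.-O. Schreyer, *On the rank of
a symmetric form*, J. Algebra **346** (2011) 340–342 = arXiv:1104.3648 [`RanestadSchreyer2011`], p. 2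
of the held text `paper:arxiv-1104.3648`:

**Corollary 2.** "If `F` is a monomial, `F = x_0^{d_0} · x_1^{d_1} · … · x_n^{d_n}` with
`d_0 ≤ d_1 ≤ … ≤ d_n`, then the cactus rank and the smoothable rank coincide and equals
`cr(F) = sr(F) = (d_0+1) · … · (d_{n-1}+1)`. If furthermore `d_n = d_0 = d`, i.e.
`F = (x_0 · x_1 · … · x_n)^d`, then `r(F) = cr(F) = sr(F) = (d+1)^n`." Printed proof: "`F^⊥` is the
complete intersection generated by the forms `y_0^{d_0+1}, y_1^{d_1+1}, …, y_n^{d_n+1}`. So it is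
generated in degree `d_n+1`, while `F^⊥` has degree `(d_0+1)·(d_1+1)·…·(d_n+1)`. The formula for the
cactus rank follows, since the first `n` generators define a finite apolar subscheme of degree
`(d_0+1)·…·(d_{n-1}+1)`."

Everything below is PROVED (no named facts, no new definitions); the cactus rank is not introduced as a
definition but, as in `Shafiei15CactusRankBound.lean`, every statement about `cr(F)` is typed in the
`∀/∃` form over its dictionary: "zero-dimensional scheme `Γ ⊂ ℙ(S₁)` of degree `e` apolar to `F`" =
"homogeneous SATURATED ideal `I ⊆ annihilatorIdeal F` whose Hilbert function
`finrank S_t − finrank (idealDegree I t)` equals `e` for all large `t`" (see that file's module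
docstring; not repeated here).

## Contents (source item → declaration)

| source item | Lean |
|---|---|
| "`F^⊥` is the complete intersection `(y_0^{d_0+1}, …, y_n^{d_n+1})`" | `MonomialCactus.annihilatorIdeal_monomial` (char `0`) |
| "`F^⊥` has degree `(d_0+1)⋯(d_n+1)`" (its Hilbert function / length) | `MonomialCactus.hilbertFunction_annihilatorIdeal_monomial`, `MonomialCactus.sum_hilbertFunction_annihilatorIdeal_monomial` |
| Cor. 2, `cr(F) ≥ (d_0+1)⋯(d_{n-1}+1)` (from Prop. 1 with `d = d_n + 1`) | **`RS2011_cor_2_lower`** |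
| "the first `n` generators define a finite apolar subscheme of degree `(d_0+1)⋯(d_{n-1}+1)`" | **`RS2011_cor_2_attained`** (any field) |
| Cor. 2, the cactus-rank equality as `∀`-bound ∧ `∃`-witness | **`RS2011_cor_2_cactus`** |
| the square-free case `x_0 ⋯ x_n` (`d = 1`): `cr = 2^n` | **`RS2011_cor_2_squarefree`** (`2^{|σ|-1}` in `|σ|` variables) |

The index `i₀` plays `n` (ANY index of maximal exponent — the statement is given for each of them,
not for a chosen ordering `d_0 ≤ … ≤ d_n`); `∏_{i ≠ i₀} (d_i+1)` is `∏ i ∈ univ.erase i₀, (d i + 1)`.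

## Proof (the printed one)

* `Ann(x^d) = (y_i^{d_i+1} : i)`: `⊇` since `∂^{e} x^d = 0` for `e ≰ d`
  (`apolarAction_monomial_monomial_of_not_le`); `⊆` because the coefficient of `x^{d-c}` in
  `D ⌟ x^d` is `D_c · ∏_i d_i!/(d_i-c_i)!` for `c ≤ d` (`apolarAction_monomial_monomial`), and these
  descending factorials are NON-ZERO IN CHARACTERISTIC `0` — the one place `CharZero K` is used (with
  the contraction / divided-power action of Shafiei and Iarrobino–Kanev the statement is
  characteristic-free; with the tree's differentiation action `apolarAction` it needs
  `char K = 0` or `char K > max d_i`; we assume `CharZero K`).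
* Hilbert functions of monomial ideals are counted by the tree's Macaulay count
  `Literature.RingTheory.MvPolynomial.finrank_idealDegree_span_monomial` (`LeadingExponents.lean`,
  any monomial order — one is put on the finite index type inside the proofs):
  `H(S/Ann(x^d); t) = #{c ≤ d : |c| = t}`, summing to `#{c ≤ d} = ∏ (d_i+1)` (Mathlib
  `Finsupp.card_Iic`); and for the witness `I₀ = (y_i^{d_i+1} : i ≠ i₀)`,
  `H(S/I₀; t) = #{c : |c| = t, c_i ≤ d_i (i ≠ i₀)} = ∏_{i≠i₀}(d_i+1)` once `t ≥ Σ_{i≠i₀} d_i`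
  (forget the `i₀`-coordinate: a bijection onto `{c' ≤ d off i₀}`); `I₀` is homogeneous (monomial
  ideal, Mathlib `Ideal.homogeneous_span`), saturated (`X_{i₀} f ∈ I₀ ⇒ f ∈ I₀`, as no generator
  involves `X_{i₀}`; via `mem_ideal_span_monomial_image`, `support_X_mul`) and apolar (any field).
* The lower bound is `sum_hilbertFunction_annihilatorIdeal_le_mul_degree`
  (`Shafiei15CactusRankBound.lean`, RS Prop. 1 for schemes) with `δ = d_{i₀}+1`:
  `∏_i (d_i+1) ≤ (d_{i₀}+1)·e`; it inherits that theorem's `Infinite K` (automatic in characteristic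
  `0`).

NOT typed: the smoothable rank `sr(F)` ("any complete intersection is smoothable") and the
Waring-rank clause `d_0 = d_n ⇒ r(F) = cr(F)` (Bertini); nothing about determinants/permanents — a
monomial toy case with no separation content (Theses/ForgivenCollisions: "the Waring / power-sum rung
… the toy model where Pratt2019 / RanestadSchreyer2011 live"). VP ≠ VNP is not touched.

## References

* K. Ranestad, F.-O. Schreyer, *On the rank of a symmetric form*, J. Algebra 346 (2011) 340–342,
  Corollary 2 (and Proposition 1). [`RanestadSchreyer2011`]
* A. Iarrobino, V. Kanev, *Power sums, Gorenstein algebras, and determinantal loci*, LNM 1721 (1999),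
  §1.1 (apolarity; the monomial complete intersection). [`IarrobinoKanev1999`]
-/

noncomputable section

open MvPolynomial Module Finset

attribute [local instance] MvPolynomial.gradedAlgebra

namespace Literature.Computability.AlgebraicComplexity

open Literature.RingTheory.MvPolynomial (idealDegree mem_idealDegree finrank_idealDegree_le
  hilbert_antitone finrank_idealDegree_span_monomial)

namespace MonomialCactus

variable {K : Type*} [Field K] {σ : Type*}

/-! ### (a) The apolar ideal of a monomial is the complete intersection `(y_i^{d_i+1} : i)` -/

/-- The exponents of the monomials in `Ann(x^d)`: those NOT below `d`. An upper set. [folklore] -/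
private theorem isUpperSet_not_le (d : σ →₀ ℕ) : IsUpperSet {c : σ →₀ ℕ | ¬ c ≤ d} :=
  fun _ _ hab ha hb => ha (hab.trans hb)

/-- `(X_i^{d_i+1} : i) = ⟨x^c : c ≰ d⟩` as ideals (both are the monomial ideal of exponents not below
`d`). [folklore] -/
private theorem span_X_pow_succ_eq_span_monomial (d : σ →₀ ℕ) :
    Ideal.span (Set.range fun i : σ => (X i : MvPolynomial σ K) ^ (d i + 1)) =
      Ideal.span ((fun c => monomial c (1 : K)) '' {c : σ →₀ ℕ | ¬ c ≤ d}) := by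
  classical
  apply le_antisymm
  · rw [Ideal.span_le]
    rintro _ ⟨i, rfl⟩
    refine Ideal.subset_span ⟨Finsupp.single i (d i + 1), ?_, ?_⟩
    · intro h
      have := h i
      rw [Finsupp.single_eq_same] at this
      omega
    · simp only [X_pow_eq_monomial]
  · rw [Ideal.span_le]
    rintro _ ⟨c, hc, rfl⟩
    obtain ⟨i, hi⟩ : ∃ i, d i < c i := by
      by_contra h
      push Not at h
      exact hc fun i => h i
    have hce : c - Finsupp.single i (d i + 1) + Finsupp.single i (d i + 1) = c := by
      ext j
      rw [Finsupp.add_apply, Finsupp.tsub_apply]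
      by_cases hj : j = i
      · subst hj; rw [Finsupp.single_eq_same]; omega
      · rw [Finsupp.single_eq_of_ne hj]; omega
    have hsplit : monomial c (1 : K) =
        monomial (c - Finsupp.single i (d i + 1)) (1 : K) * X i ^ (d i + 1) := by
      rw [X_pow_eq_monomial, monomial_mul, mul_one, hce]
    change monomial c (1 : K) ∈ _
    rw [hsplit]
    exact Ideal.mul_mem_left _ _ (Ideal.subset_span ⟨i, rfl⟩)

/-- `x^c ⌟ x^d` for `c ≤ d` is `(∏ descFactorial) · x^{d-c}` with a NON-ZERO integer coefficient;
here: the coefficient of `x^{d-c}` in `D ⌟ x^d` is `D_c · ∏_i d_i!/(d_i-c_i)!`. [folklore] -/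
private theorem coeff_apolarAction_monomial [DecidableEq σ] (D : MvPolynomial σ K) (d c : σ →₀ ℕ)
    (hc : c ≤ d) :
    coeff (d - c) (apolarAction D (monomial d (1 : K))) =
      coeff c D * ∏ i ∈ c.support, (Nat.descFactorial (d i) (c i) : K) := by
  classical
  conv_lhs => rw [D.as_sum, apolarAction_sum_left]
  rw [coeff_sum, Finset.sum_eq_single c]
  · rw [apolarAction_monomial_monomial, coeff_monomial, if_pos rfl, mul_one]
  · intro c' hc' hne
    by_cases hle : c' ≤ d
    · rw [apolarAction_monomial_monomial, coeff_monomial, if_neg]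
      intro h
      apply hne
      -- `d - c' = d - c` with `c, c' ≤ d` forces `c' = c`
      ext j
      have h1 := congrArg (fun f : σ →₀ ℕ => f j) h
      simp only [Finsupp.coe_tsub, Pi.sub_apply] at h1
      have h2 := hle j
      have h3 := hc j
      omega
    · rw [apolarAction_monomial_monomial_of_not_le hle, coeff_zero]
  · intro hc'
    rw [notMem_support_iff.1 hc', monomial_zero, apolarAction_zero_left, coeff_zero]

/-- **The apolar ideal of a monomial** (Ranestad–Schreyer 2011, proof of Cor. 2: "When
`F = x_0^{d_0} ⋯ x_n^{d_n}`, then `F^⊥` is the complete intersection generated by the forms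
`y_0^{d_0+1}, …, y_n^{d_n+1}`"), over a field of characteristic `0` and for the tree's
differentiation action `apolarAction`. [cite: RanestadSchreyer2011, Corollary 2 (proof)] -/
theorem annihilatorIdeal_monomial [CharZero K] (d : σ →₀ ℕ) :
    annihilatorIdeal (monomial d (1 : K)) =
      Ideal.span (Set.range fun i : σ => (X i : MvPolynomial σ K) ^ (d i + 1)) := by
  classical
  rw [span_X_pow_succ_eq_span_monomial]
  apply le_antisymm
  · intro D hD
    rw [mem_annihilatorIdeal_iff] at hD
    rw [mem_ideal_span_monomial_image]
    intro c hc
    refine ⟨c, ?_, le_rfl⟩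
    intro hcd
    have h := coeff_apolarAction_monomial D d c hcd
    rw [hD, coeff_zero] at h
    refine (mem_support_iff.1 hc) ?_
    refine (mul_eq_zero.1 h.symm).resolve_right ?_
    refine Finset.prod_ne_zero_iff.2 fun i _ => ?_
    rw [Nat.cast_ne_zero, Ne, Nat.descFactorial_eq_zero_iff_lt, not_lt]
    exact hcd i
  · rw [Ideal.span_le]
    rintro _ ⟨c, hc, rfl⟩
    rw [SetLike.mem_coe, mem_annihilatorIdeal_iff]
    exact apolarAction_monomial_monomial_of_not_le hc 1 1

/-! ### (b) The Hilbert function and the length `∏ (d_i + 1)` of `S/Ann(x^d)` -/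

section Hilbert

variable [Fintype σ] [DecidableEq σ]

/-- Macaulay's count for a monomial ideal, with the monomial order supplied (any finite `σ`).
[folklore] -/
private theorem finrank_idealDegree_span_monomial' {E : Set (σ →₀ ℕ)} (hE : IsUpperSet E) (t : ℕ)
    [DecidablePred (· ∈ E)] :
    finrank K (idealDegree (Ideal.span ((fun a => monomial a (1 : K)) '' E)) t) =
      (((univ : Finset σ).finsuppAntidiag t).filter (· ∈ E)).card := by
  letI : LinearOrder σ := LinearOrder.lift' (Fintype.equivFin σ) (Fintype.equivFin σ).injective
  exact finrank_idealDegree_span_monomial MonomialOrder.lex hE t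

/-- `dim S_t` is the number of exponents of degree `t`. [folklore] -/
private theorem finrank_homogeneousSubmodule_eq_card (t : ℕ) :
    finrank K (homogeneousSubmodule σ K t) = ((univ : Finset σ).finsuppAntidiag t).card := by
  classical
  have htop : Ideal.span ((fun a => monomial a (1 : K)) '' (Set.univ : Set (σ →₀ ℕ))) = ⊤ :=
    Ideal.eq_top_of_isUnit_mem _ (Ideal.subset_span ⟨0, Set.mem_univ _, rfl⟩) isUnit_one
  have h := finrank_idealDegree_span_monomial' (K := K) (E := (Set.univ : Set (σ →₀ ℕ)))
    isUpperSet_univ t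
  rw [htop, Literature.RingTheory.MvPolynomial.idealDegree_top,
    Finset.filter_true_of_mem (fun _ _ => Set.mem_univ _)] at h
  exact h

/-- **Hilbert function of the apolar algebra of a monomial**: `H(S/Ann(x^d); t)` is the number of
exponents `c ≤ d` of degree `t` (the standard monomials of the complete intersection
`(y_i^{d_i+1})`). Characteristic `0`. [cite: RanestadSchreyer2011, Corollary 2 (proof)] -/
theorem hilbertFunction_annihilatorIdeal_monomial [CharZero K] (d : σ →₀ ℕ) (t : ℕ) :
    finrank K (homogeneousSubmodule σ K t) -
        finrank K (idealDegree (annihilatorIdeal (monomial d (1 : K))) t) =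
      (((univ : Finset σ).finsuppAntidiag t).filter (· ≤ d)).card := by
  classical
  rw [annihilatorIdeal_monomial, span_X_pow_succ_eq_span_monomial,
    finrank_idealDegree_span_monomial' (isUpperSet_not_le d), finrank_homogeneousSubmodule_eq_card]
  have h := Finset.card_filter_add_card_filter_not
    (s := (univ : Finset σ).finsuppAntidiag t) (fun c : σ →₀ ℕ => c ≤ d)
  have h' : (((univ : Finset σ).finsuppAntidiag t).filter (fun c : σ →₀ ℕ => ¬ c ≤ d)).card =
      (((univ : Finset σ).finsuppAntidiag t).filter (· ∈ {c : σ →₀ ℕ | ¬ c ≤ d})).card := rfl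
  omega

/-- The number of exponents below `d` is `∏_i (d_i + 1)`. [folklore] -/
private theorem card_Iic_eq_prod (d : σ →₀ ℕ) : (Finset.Iic d).card = ∏ i, (d i + 1) := by
  rw [Finsupp.card_Iic]
  rw [Finset.prod_subset (Finset.subset_univ d.support)]
  · exact Finset.prod_congr rfl fun i _ => Nat.card_Iic _
  · intro i _ hi
    rw [Finsupp.notMem_support_iff.1 hi, Nat.card_Iic, zero_add]

/-- **Length of the apolar algebra of a monomial**: `Σ_t H(S/Ann(x^d); t) = ∏_i (d_i + 1)` — "`F^⊥`
has degree `(d_0+1)(d_1+1)⋯(d_n+1)`" (the sum over `t ≤ T` for any `T ≥ |d|`; the Hilbert function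
vanishes above `|d|`). Characteristic `0`. [cite: RanestadSchreyer2011, Corollary 2 (proof)] -/
theorem sum_hilbertFunction_annihilatorIdeal_monomial [CharZero K] (d : σ →₀ ℕ) {T : ℕ}
    (hT : d.degree ≤ T) :
    ∑ t ∈ range (T + 1), (finrank K (homogeneousSubmodule σ K t) -
        finrank K (idealDegree (annihilatorIdeal (monomial d (1 : K))) t)) = ∏ i, (d i + 1) := by
  classical
  rw [← card_Iic_eq_prod, Finset.card_eq_sum_card_fiberwise (f := Finsupp.degree) (s := Finset.Iic d)
    (t := range (T + 1)) fun c hc => ?_]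
  · refine Finset.sum_congr rfl fun t _ => ?_
    rw [hilbertFunction_annihilatorIdeal_monomial]
    congr 1
    ext c
    rw [mem_filter, mem_filter, Finset.mem_Iic,
      Literature.RingTheory.MvPolynomial.mem_finsuppAntidiag_univ_iff, and_comm]
  · rw [Finset.coe_Iic, Set.mem_Iic] at hc
    rw [Finset.mem_coe, Finset.mem_range]
    have := Finsupp.degree_mono hc
    omega

end Hilbert

/-! ### (d) The witness `(y_i^{d_i+1} : i ≠ i₀)`: an apolar zero-dimensional scheme of degree
`∏_{i ≠ i₀} (d_i + 1)` -/

section Witness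

variable [Fintype σ] [DecidableEq σ]

omit [Fintype σ] in
/-- `(X_i^{d_i+1} : i ≠ i₀) = ⟨x^c : c_i > d_i for some i ≠ i₀⟩`. [folklore] -/
private theorem span_X_pow_succ_erase_eq_span_monomial (d : σ →₀ ℕ) (i₀ : σ) :
    Ideal.span ((fun i : σ => (X i : MvPolynomial σ K) ^ (d i + 1)) '' {i | i ≠ i₀}) =
      Ideal.span ((fun c => monomial c (1 : K)) '' {c : σ →₀ ℕ | ∃ i, i ≠ i₀ ∧ d i < c i}) := by
  classical
  apply le_antisymm
  · rw [Ideal.span_le]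
    rintro _ ⟨i, hi, rfl⟩
    refine Ideal.subset_span ⟨Finsupp.single i (d i + 1), ⟨i, hi, ?_⟩, ?_⟩
    · rw [Finsupp.single_eq_same]; omega
    · simp only [X_pow_eq_monomial]
  · rw [Ideal.span_le]
    rintro _ ⟨c, ⟨i, hi, hic⟩, rfl⟩
    have hce : c - Finsupp.single i (d i + 1) + Finsupp.single i (d i + 1) = c := by
      ext j
      rw [Finsupp.add_apply, Finsupp.tsub_apply]
      by_cases hj : j = i
      · subst hj; rw [Finsupp.single_eq_same]; omega
      · rw [Finsupp.single_eq_of_ne hj]; omega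
    have hsplit : monomial c (1 : K) =
        monomial (c - Finsupp.single i (d i + 1)) (1 : K) * X i ^ (d i + 1) := by
      rw [X_pow_eq_monomial, monomial_mul, mul_one, hce]
    change monomial c (1 : K) ∈ _
    rw [hsplit]
    exact Ideal.mul_mem_left _ _ (Ideal.subset_span ⟨i, hi, rfl⟩)

omit [Fintype σ] [DecidableEq σ] in
/-- The exponents `{c : c_i > d_i for some i ≠ i₀}` form an upper set. [folklore] -/
private theorem isUpperSet_exists_lt (d : σ →₀ ℕ) (i₀ : σ) :
    IsUpperSet {c : σ →₀ ℕ | ∃ i, i ≠ i₀ ∧ d i < c i} :=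
  fun _ _ hab ⟨i, hi, hlt⟩ => ⟨i, hi, hlt.trans_le (hab i)⟩

omit [Fintype σ] [DecidableEq σ] in
/-- The witness ideal is homogeneous (a monomial ideal). [folklore] -/
private theorem isHomogeneous_span_X_pow_succ_erase (d : σ →₀ ℕ) (i₀ : σ) :
    (Ideal.span ((fun i : σ => (X i : MvPolynomial σ K) ^ (d i + 1)) '' {i | i ≠ i₀})).IsHomogeneous
      (homogeneousSubmodule σ K) := by
  refine Ideal.homogeneous_span _ _ fun x hx => ?_
  obtain ⟨i, -, rfl⟩ := hx
  exact ⟨d i + 1, (mem_homogeneousSubmodule _ _).2 (isHomogeneous_X_pow i (d i + 1))⟩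

omit [Fintype σ] in
/-- The witness ideal is SATURATED: `X_{i₀}` (indeed every variable) times `f` in it forces `f` in
it, because its generators do not involve `X_{i₀}`. [folklore] -/
private theorem saturated_span_X_pow_succ_erase (d : σ →₀ ℕ) (i₀ : σ) (f : MvPolynomial σ K)
    (hf : ∀ i, X i * f ∈
      Ideal.span ((fun i : σ => (X i : MvPolynomial σ K) ^ (d i + 1)) '' {i | i ≠ i₀})) :
    f ∈ Ideal.span ((fun i : σ => (X i : MvPolynomial σ K) ^ (d i + 1)) '' {i | i ≠ i₀}) := by
  classical
  have h := hf i₀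
  rw [span_X_pow_succ_erase_eq_span_monomial, mem_ideal_span_monomial_image] at h ⊢
  intro c hc
  have hc' : Finsupp.single i₀ 1 + c ∈ (X i₀ * f).support := by
    rw [support_X_mul]
    exact Finset.mem_map_of_mem _ hc
  obtain ⟨e, ⟨i, hi, hie⟩, hec⟩ := h _ hc'
  refine ⟨c, ⟨i, hi, ?_⟩, le_rfl⟩
  have := hec i
  rw [Finsupp.add_apply, Finsupp.single_eq_of_ne hi] at this
  omega

omit [Fintype σ] in
/-- The witness ideal is apolar to `x^d` (each `y_i^{d_i+1}` kills `x^d`; any characteristic).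
[folklore] -/
private theorem span_X_pow_succ_erase_le_annihilatorIdeal (d : σ →₀ ℕ) (i₀ : σ) :
    Ideal.span ((fun i : σ => (X i : MvPolynomial σ K) ^ (d i + 1)) '' {i | i ≠ i₀}) ≤
      annihilatorIdeal (monomial d (1 : K)) := by
  classical
  rw [Ideal.span_le]
  rintro _ ⟨i, -, rfl⟩
  rw [SetLike.mem_coe, mem_annihilatorIdeal_iff]
  dsimp only
  rw [X_pow_eq_monomial]
  refine apolarAction_monomial_monomial_of_not_le (fun h => ?_) 1 1
  have := h i
  rw [Finsupp.single_eq_same] at this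
  omega

omit [Fintype σ] [DecidableEq σ] in
/-- The degree of an exponent splits off the `i₀`-coordinate. [folklore] -/
private theorem degree_eq_degree_erase_add (c : σ →₀ ℕ) (i₀ : σ) :
    c.degree = (c.erase i₀).degree + c i₀ := by
  conv_lhs => rw [← Finsupp.erase_add_single i₀ c]
  rw [map_add, Finsupp.degree_single]

/-- **Counting the standard monomials of the witness in high degree**: for `t ≥ Σ_{i ≠ i₀} d_i`,
the exponents `c` of degree `t` with `c_i ≤ d_i` for all `i ≠ i₀` are in bijection with the
exponents below `d` off `i₀` (forget `c_{i₀}`, which is determined by the degree), so there are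
`∏_{i ≠ i₀} (d_i + 1)` of them. [folklore] -/
private theorem card_filter_forall_ne_le (d : σ →₀ ℕ) (i₀ : σ) {t : ℕ}
    (ht : (d.erase i₀).degree ≤ t) :
    (((univ : Finset σ).finsuppAntidiag t).filter
        (fun c : σ →₀ ℕ => ∀ i, i ≠ i₀ → c i ≤ d i)).card = ∏ i ∈ univ.erase i₀, (d i + 1) := by
  classical
  have hprod : ∏ i ∈ univ.erase i₀, (d i + 1) = (Finset.Iic (d.erase i₀)).card := by
    rw [card_Iic_eq_prod, ← Finset.prod_erase_mul _ _ (Finset.mem_univ i₀), Finsupp.erase_same,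
      zero_add, mul_one]
    exact Finset.prod_congr rfl fun i hi => by rw [Finsupp.erase_ne (Finset.ne_of_mem_erase hi)]
  rw [hprod]
  refine Finset.card_nbij' (fun c => c.erase i₀)
    (fun c' => c' + Finsupp.single i₀ (t - c'.degree)) ?_ ?_ ?_ ?_
  · intro c hc
    rw [Finset.mem_coe, mem_filter, Literature.RingTheory.MvPolynomial.mem_finsuppAntidiag_univ_iff] at hc
    rw [Finset.mem_coe, Finset.mem_Iic]
    intro j
    by_cases hj : j = i₀
    · subst hj; rw [Finsupp.erase_same, Finsupp.erase_same]
    · rw [Finsupp.erase_ne hj, Finsupp.erase_ne hj]; exact hc.2 j hj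
  · intro c' hc'
    rw [Finset.mem_coe, Finset.mem_Iic] at hc'
    have hdeg : c'.degree ≤ t := (Finsupp.degree_mono hc').trans ht
    rw [Finset.mem_coe, mem_filter, Literature.RingTheory.MvPolynomial.mem_finsuppAntidiag_univ_iff]
    refine ⟨?_, fun j hj => ?_⟩
    · rw [map_add, Finsupp.degree_single]; omega
    · rw [Finsupp.add_apply, Finsupp.single_eq_of_ne hj, add_zero]
      have := hc' j
      rwa [Finsupp.erase_ne hj] at this
  · intro c hc
    rw [Finset.mem_coe, mem_filter, Literature.RingTheory.MvPolynomial.mem_finsuppAntidiag_univ_iff] at hc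
    have hdeg := degree_eq_degree_erase_add c i₀
    have : t - (c.erase i₀).degree = c i₀ := by omega
    change c.erase i₀ + Finsupp.single i₀ (t - (c.erase i₀).degree) = c
    rw [this, Finsupp.erase_add_single]
  · intro c' hc'
    rw [Finset.mem_coe, Finset.mem_Iic] at hc'
    have h0 : c' i₀ = 0 := by have := hc' i₀; rw [Finsupp.erase_same] at this; omega
    change (c' + Finsupp.single i₀ (t - c'.degree)).erase i₀ = c'
    rw [Finsupp.erase_add, Finsupp.erase_single, add_zero]
    ext j
    by_cases hj : j = i₀
    · subst hj; rw [Finsupp.erase_same, h0]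
    · rw [Finsupp.erase_ne hj]

/-- **Hilbert function of the witness**: `H(S/(y_i^{d_i+1} : i ≠ i₀); t) = ∏_{i≠i₀}(d_i+1)` for all
`t ≥ Σ_{i≠i₀} d_i` (`S/I₀ = K[y_{i₀}] ⊗ K[y_i : i ≠ i₀]/(y_i^{d_i+1})`; counted through the tree's
`finrank_idealDegree_span_monomial`). [folklore] -/
private theorem hilbertFunction_span_X_pow_succ_erase (d : σ →₀ ℕ) (i₀ : σ) {t : ℕ}
    (ht : (d.erase i₀).degree ≤ t) :
    finrank K (homogeneousSubmodule σ K t) -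
        finrank K (idealDegree
          (Ideal.span ((fun i : σ => (X i : MvPolynomial σ K) ^ (d i + 1)) '' {i | i ≠ i₀})) t) =
      ∏ i ∈ univ.erase i₀, (d i + 1) := by
  classical
  rw [span_X_pow_succ_erase_eq_span_monomial,
    finrank_idealDegree_span_monomial' (isUpperSet_exists_lt d i₀), finrank_homogeneousSubmodule_eq_card,
    ← card_filter_forall_ne_le d i₀ ht]
  have h := Finset.card_filter_add_card_filter_not
    (s := (univ : Finset σ).finsuppAntidiag t) (fun c : σ →₀ ℕ => ∃ i, i ≠ i₀ ∧ d i < c i)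
  have h1 : (((univ : Finset σ).finsuppAntidiag t).filter
      (fun c : σ →₀ ℕ => ¬ ∃ i, i ≠ i₀ ∧ d i < c i)).card =
      (((univ : Finset σ).finsuppAntidiag t).filter (fun c : σ →₀ ℕ => ∀ i, i ≠ i₀ → c i ≤ d i)).card := by
    congr 1
    ext c
    simp only [mem_filter, not_exists, not_and, not_lt]
  have h2 : (((univ : Finset σ).finsuppAntidiag t).filter
      (fun c : σ →₀ ℕ => ∃ i, i ≠ i₀ ∧ d i < c i)).card =
      (((univ : Finset σ).finsuppAntidiag t).filter
        (· ∈ {c : σ →₀ ℕ | ∃ i, i ≠ i₀ ∧ d i < c i})).card := rfl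
  omega

end Witness


end MonomialCactus

/-! ### (c) Ranestad–Schreyer, Corollary 2 -/

section Corollary2

open MonomialCactus

variable {K : Type*} [Field K] {σ : Type*} [Fintype σ] [DecidableEq σ]

/-- **RS Cor. 2, lower bound**: for `F = x^d` and an index `i₀` of MAXIMAL exponent, every
zero-dimensional scheme apolar to `F` (every homogeneous saturated ideal `I ⊆ Ann(x^d)` whose Hilbert
function is eventually `e`, dictionary of `Shafiei15CactusRankBound.lean`) has
`e ≥ ∏_{i ≠ i₀} (d_i + 1)` — Prop. 1 (`sum_hilbertFunction_annihilatorIdeal_le_mul_degree`) with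
`Ann(x^d) = (y_i^{d_i+1})` generated in degree `≤ d_{i₀} + 1` and of length `∏_i (d_i+1)`.
Characteristic `0`. [cite: RanestadSchreyer2011, Corollary 2] -/
theorem RS2011_cor_2_lower [CharZero K] (d : σ →₀ ℕ) {i₀ : σ} (hi₀ : ∀ i, d i ≤ d i₀)
    {I : Ideal (MvPolynomial σ K)} (hIhom : I.IsHomogeneous (homogeneousSubmodule σ K))
    (hsat : ∀ f, (∀ i, X i * f ∈ I) → f ∈ I) (hIF : I ≤ annihilatorIdeal (monomial d (1 : K)))
    {e t₀ : ℕ} (he : ∀ t, t₀ ≤ t →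
      finrank K (homogeneousSubmodule σ K t) - finrank K (idealDegree I t) = e) :
    ∏ i ∈ univ.erase i₀, (d i + 1) ≤ e := by
  haveI : Infinite K := Infinite.of_injective ((↑) : ℕ → K) Nat.cast_injective
  have h := sum_hilbertFunction_annihilatorIdeal_le_mul_degree (isHomogeneous_monomial (1 : K) rfl)
    (δ := d i₀ + 1) (G := Set.range fun i : σ => (X i : MvPolynomial σ K) ^ (d i + 1))
    (by
      rintro _ ⟨i, rfl⟩
      exact ⟨d i + 1, by have := hi₀ i; omega, isHomogeneous_X_pow i (d i + 1)⟩)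
    (annihilatorIdeal_monomial d) hIhom hsat hIF he d.degree
  rw [sum_hilbertFunction_annihilatorIdeal_monomial d le_rfl,
    ← Finset.mul_prod_erase univ (fun i => d i + 1) (Finset.mem_univ i₀)] at h
  exact Nat.le_of_mul_le_mul_left h (Nat.succ_pos _)

/-- **RS Cor. 2, the bound is attained**: the ideal `(y_i^{d_i+1} : i ≠ i₀)` is homogeneous,
saturated, apolar to `x^d`, with Hilbert function equal to `∏_{i≠i₀}(d_i+1)` from degree
`Σ_{i≠i₀} d_i` on ("the first `n` generators define a finite apolar subscheme of degree
`(d_0+1)⋯(d_{n-1}+1)`"). Any field, any `i₀`. [cite: RanestadSchreyer2011, Corollary 2] -/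
theorem RS2011_cor_2_attained (d : σ →₀ ℕ) (i₀ : σ) :
    ∃ I : Ideal (MvPolynomial σ K), I.IsHomogeneous (homogeneousSubmodule σ K) ∧
      (∀ f, (∀ i, X i * f ∈ I) → f ∈ I) ∧ I ≤ annihilatorIdeal (monomial d (1 : K)) ∧
      ∀ t, (d.erase i₀).degree ≤ t →
        finrank K (homogeneousSubmodule σ K t) - finrank K (idealDegree I t) =
          ∏ i ∈ univ.erase i₀, (d i + 1) :=
  ⟨_, isHomogeneous_span_X_pow_succ_erase d i₀, saturated_span_X_pow_succ_erase d i₀,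
    span_X_pow_succ_erase_le_annihilatorIdeal d i₀, fun _ ht => hilbertFunction_span_X_pow_succ_erase d i₀ ht⟩

/-- **Ranestad–Schreyer 2011, Corollary 2** ("If `F = x_0^{d_0} ⋯ x_n^{d_n}` with
`d_0 ≤ d_1 ≤ … ≤ d_n`, then the cactus rank … equals `cr(F) = (d_0+1)⋯(d_{n-1}+1)`"), in the
tree's `∀/∃` form over the dictionary "zero-dimensional apolar scheme of degree `e`" = "homogeneous
saturated `I ⊆ Ann(F)` with Hilbert function eventually `e`" (`Shafiei15CactusRankBound.lean`): with
`i₀` any index of maximal exponent, (1) every such `I` has `e ≥ ∏_{i≠i₀}(d_i+1)` and (2) some such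
`I` has Hilbert function eventually `∏_{i≠i₀}(d_i+1)`. Characteristic `0` (the source: any field;
needed here for `Ann(x^d) = (y_i^{d_i+1})` under the differentiation action and inherited from
Prop. 1's prime avoidance). NOT typed: "`= sr(F)`" (smoothable rank) and the Bertini clause
`d_0 = d_n ⇒ r(F) = cr(F)`. [cite: RanestadSchreyer2011, Corollary 2] -/
theorem RS2011_cor_2_cactus [CharZero K] (d : σ →₀ ℕ) {i₀ : σ} (hi₀ : ∀ i, d i ≤ d i₀) :
    (∀ (I : Ideal (MvPolynomial σ K)), I.IsHomogeneous (homogeneousSubmodule σ K) →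
      (∀ f, (∀ i, X i * f ∈ I) → f ∈ I) → I ≤ annihilatorIdeal (monomial d (1 : K)) →
      ∀ e t₀ : ℕ, (∀ t, t₀ ≤ t →
        finrank K (homogeneousSubmodule σ K t) - finrank K (idealDegree I t) = e) →
      ∏ i ∈ univ.erase i₀, (d i + 1) ≤ e) ∧
    ∃ I : Ideal (MvPolynomial σ K), I.IsHomogeneous (homogeneousSubmodule σ K) ∧
      (∀ f, (∀ i, X i * f ∈ I) → f ∈ I) ∧ I ≤ annihilatorIdeal (monomial d (1 : K)) ∧
      ∃ t₀ : ℕ, ∀ t, t₀ ≤ t →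
        finrank K (homogeneousSubmodule σ K t) - finrank K (idealDegree I t) =
          ∏ i ∈ univ.erase i₀, (d i + 1) := by
  refine ⟨fun I hIhom hsat hIF e t₀ he => RS2011_cor_2_lower d hi₀ hIhom hsat hIF he, ?_⟩
  obtain ⟨I, h1, h2, h3, h4⟩ := RS2011_cor_2_attained (K := K) d i₀
  exact ⟨I, h1, h2, h3, (d.erase i₀).degree, h4⟩

omit [DecidableEq σ] in
/-- The square-free monomial: `x^d = ∏_i x_i` when all `d_i = 1`. [folklore] -/
private theorem monomial_eq_prod_X {d : σ →₀ ℕ} (hd : ∀ i, d i = 1) :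
    monomial d (1 : K) = ∏ i, (X i : MvPolynomial σ K) := by
  rw [← prod_X_pow_eq_monomial]
  have hsupp : d.support = univ := by
    ext i; simp [Finsupp.mem_support_iff, hd i]
  rw [hsupp]
  exact Finset.prod_congr rfl fun i _ => by rw [hd i, pow_one]

/-- **RS Cor. 2 for `x_1 ⋯ x_n`** (the case `d_0 = … = d_n = 1`: "`r(F) = cr(F) = sr(F) = (d+1)^n`"
with `d = 1`, here the cactus part): for the square-free monomial `∏_{i ∈ σ} x_i` in `|σ|`
variables, every zero-dimensional apolar scheme has degree `≥ 2^{|σ|-1}` and one has Hilbert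
function eventually `2^{|σ|-1}` — "cr(`x_1⋯x_n`) `= 2^{n-1}`" (the number route
`ForgivenCollisions` quotes for its Waring/power-sum rung). Characteristic `0`; `σ` non-empty via
`i₀`. [cite: RanestadSchreyer2011, Corollary 2] -/
theorem RS2011_cor_2_squarefree [CharZero K] {d : σ →₀ ℕ} (hd : ∀ i, d i = 1) (i₀ : σ) :
    monomial d (1 : K) = ∏ i, (X i : MvPolynomial σ K) ∧
    (∀ (I : Ideal (MvPolynomial σ K)), I.IsHomogeneous (homogeneousSubmodule σ K) →
      (∀ f, (∀ i, X i * f ∈ I) → f ∈ I) → I ≤ annihilatorIdeal (monomial d (1 : K)) →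
      ∀ e t₀ : ℕ, (∀ t, t₀ ≤ t →
        finrank K (homogeneousSubmodule σ K t) - finrank K (idealDegree I t) = e) →
      2 ^ (Fintype.card σ - 1) ≤ e) ∧
    ∃ I : Ideal (MvPolynomial σ K), I.IsHomogeneous (homogeneousSubmodule σ K) ∧
      (∀ f, (∀ i, X i * f ∈ I) → f ∈ I) ∧ I ≤ annihilatorIdeal (monomial d (1 : K)) ∧
      ∃ t₀ : ℕ, ∀ t, t₀ ≤ t →
        finrank K (homogeneousSubmodule σ K t) - finrank K (idealDegree I t) =
          2 ^ (Fintype.card σ - 1) := by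
  have hprod : ∏ i ∈ univ.erase i₀, (d i + 1) = 2 ^ (Fintype.card σ - 1) := by
    rw [Finset.prod_congr rfl fun i _ => by rw [hd i], Finset.prod_const, Finset.card_erase_of_mem
      (Finset.mem_univ i₀), Finset.card_univ]
  obtain ⟨h1, h2⟩ := RS2011_cor_2_cactus (K := K) d (i₀ := i₀) fun i => by rw [hd i, hd i₀]
  rw [hprod] at h1 h2
  exact ⟨monomial_eq_prod_X hd, h1, h2⟩

end Corollary2


end Literature.Computability.AlgebraicComplexity

end
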